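import Literature.MathematicalPhysics.QuantumFieldTheory.QCDFlavourSymmetry
import Literature.MathematicalPhysics.QuantumFieldTheory.QCDTimeReflection
import HarnessLib

/-!
# Crux `TorusHalfSpectrum` (stmt-QuantumFields-9508), line `registered` (`Lines/birth.lean`, reshape v4) —
# stub `stub_osAdjoint_charge`: the Osterwalder–Seiler reflection `Θ` flips the flavour charge

Stub Θ of the birth skeleton of the crux
`Summit.QuantumFields.QCD.Theses.QuarksNoInfraredClause.TorusHalfSpectrum` (= `OsAdjointChargeStmt`
unfolded): if a gauge-invariant local lattice-QCD observable `A` is HOMOGENEOUS of charge `q ∈ ℤ^{N_f}`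
under the vector flavour torus — `flavourScale t (A.F U) = (∏_f t_f^{q_f}) • A.F U` for all `t ∈ (ℂˣ)^{N_f}`
(`ψ_f ↦ t_f ψ_f`, `ψ̄_f ↦ t_f⁻¹ ψ̄_f`) — then its Osterwalder–Seiler adjoint `ΘA = A.osAdjoint`
(`(ΘA)(U) = Θ(A(θU))`, `Θ = rev ∘ Λ(T) ∘ conj` antilinear and order reversing, `T = fermiThetaLin`:
`ψ_{f,x} ↦ ψ̄_{f,θx}γ₀`, `ψ̄_{f,x} ↦ γ₀ψ_{f,θx}` at the SAME flavour `f`) is homogeneous of charge `−q`.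
This is what makes the composite `A · τ_v ΘA` of a charged observable flavour-NEUTRAL, the input of
the neutral clustering hypothesis in the conjugate-pair core of the crux.

Proof (pattern of `fermiGaugeAct_fermiTheta` / `fermiGaugeLin_comp_fermiThetaLin` of
`QCDTimeReflection.lean`, with the diagonal flavour weights in place of the gauge rotation):

* on generator coefficients the diagonal weight map `D_s = diag (flavourWeight s)` satisfies
  `D_s ∘ T = T ∘ conj(D_{(s̄)⁻¹})` (`flavourLin_comp_fermiThetaLin`): `T` moves a `ψ_f`-coefficient to a
  `ψ̄_f`-slot of the same flavour, where the weight `s_f⁻¹ = conj ((conj s_f)⁻¹)` is the conjugate of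
  the `ψ`-weight of `(s̄)⁻¹` (and symmetrically for `ψ̄`; valid also at `s_f = 0` since `0⁻¹ = 0`);
* hence on the whole boxed Grassmann algebra `flavourScale s (Θ y) = Θ (flavourScale (s̄)⁻¹ y)`
  (`flavourScale_fermiTheta`: `reverse_map_eq`, `ExteriorAlgebra.map_comp_map`, `grassmannConj_map`);
* for homogeneous `A` and `s ∈ (ℂˣ)^{N_f}` (so `(s̄)⁻¹ ∈ (ℂˣ)^{N_f}`), antilinearity of `Θ` turns the
  character `∏_f ((s̄)⁻¹_f)^{q_f}` into `conj ∏_f ((conj s_f)⁻¹)^{q_f} = ∏_f s_f^{−q_f}`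
  (`conj_prod_star_inv_zpow`).

Everything used is proved in the tree (no named fact).  Sources: I. Montvay, G. Münster, *Quantum Fields
on a Lattice* (CUP 1994), §4.2.3 (4.91), (4.99) (the reflection `Θ`), §5.1.1 (5.6) (flavour symmetry);
K. Osterwalder, E. Seiler, Ann. Phys. 110 (1978) 440, §2.
-/

noncomputable section

namespace Summit.QuantumFields.QCD.Cruxes.TorusHalfSpectrum.Birth.OsAdjointCharge

open scoped BigOperators ComplexConjugate
open Literature.MathematicalPhysics.QuantumFieldTheory Literature.MathematicalPhysics.QuantumLattice

variable {Nf R : ℕ}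

/-! ### The flavour torus and the reflection substitution on generator coefficients -/

/-- **The diagonal flavour weights against the reflection substitution, on generator coefficients**:
`D_s ∘ T = T ∘ conj(D_{(s̄)⁻¹})`.  The substitution `T = fermiThetaLin` fills the `ψ̄_{f,y,a,β}`-slot with a
spin combination of the `ψ_{f,θy,a,·}`-coefficients (same flavour `f`), on which the weight of `D_s` is
`s_f⁻¹ = conj (((s̄)⁻¹)_f)`, the conjugate of the `ψ`-weight of `(s̄)⁻¹`; symmetrically for the `ψ`-slots
(`s_f = conj ((((s̄)⁻¹)_f)⁻¹)`). -/
theorem flavourLin_comp_fermiThetaLin (s : Fin Nf → ℂ) :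
    (LinearMap.pi fun w => QCDLatticeObservable.flavourWeight s w •
        (LinearMap.proj w : (BoxFermiIdx Nf R ⊕ₗ BoxFermiIdx Nf R → ℂ) →ₗ[ℂ] ℂ)) ∘ₗ fermiThetaLin =
      fermiThetaLin ∘ₗ conjLin (LinearMap.pi fun w => QCDLatticeObservable.flavourWeight (star s)⁻¹ w •
        (LinearMap.proj w : (BoxFermiIdx Nf R ⊕ₗ BoxFermiIdx Nf R → ℂ) →ₗ[ℂ] ℂ)) := by
  refine LinearMap.ext fun c => funext fun w => ?_
  obtain ⟨x, rfl⟩ : ∃ x, toLex x = w := ⟨ofLex w, rfl⟩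
  rcases x with i | i
  · simp only [LinearMap.comp_apply, fermiThetaLin, conjLin_apply, LinearMap.pi_apply, ofLex_toLex,
      LinearMap.coe_sum, Finset.sum_apply, LinearMap.smul_apply, LinearMap.proj_apply,
      Equiv.symm_apply_apply, Pi.star_apply, Pi.inv_apply, star_mul', star_star, star_inv₀,
      smul_eq_mul, Finset.mul_sum, QCDLatticeObservable.flavourWeight_inl,
      QCDLatticeObservable.flavourWeight_inr]
    refine Finset.sum_congr rfl fun α _ => ?_
    ring
  · simp only [LinearMap.comp_apply, fermiThetaLin, conjLin_apply, LinearMap.pi_apply, ofLex_toLex,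
      LinearMap.coe_sum, Finset.sum_apply, LinearMap.smul_apply, LinearMap.proj_apply,
      Equiv.symm_apply_apply, Pi.star_apply, Pi.inv_apply, star_mul', star_star, inv_inv,
      smul_eq_mul, Finset.mul_sum, QCDLatticeObservable.flavourWeight_inl,
      QCDLatticeObservable.flavourWeight_inr]
    refine Finset.sum_congr rfl fun α _ => ?_
    ring

/-- **The vector flavour torus against the reflection `Θ` on the boxed quark Grassmann algebra**:
`s · Θ(y) = Θ ((s̄)⁻¹ · y)` — conjugate-inverse weights because `Θ` is antilinear and exchanges `ψ_f` with
`ψ̄_f` (weights `t_f` and `t_f⁻¹`). -/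
theorem flavourScale_fermiTheta (s : Fin Nf → ℂ) (y : BoxFermiAlg Nf R) :
    QCDLatticeObservable.flavourScale s (fermiTheta y) =
      fermiTheta (QCDLatticeObservable.flavourScale (star s)⁻¹ y) := by
  simp only [fermiTheta_apply, QCDLatticeObservable.flavourScale_eq]
  rw [← reverse_map_eq, ← AlgHom.comp_apply, ExteriorAlgebra.map_comp_map, grassmannConj_map,
    ← AlgHom.comp_apply (ExteriorAlgebra.map fermiThetaLin), ExteriorAlgebra.map_comp_map,
    flavourLin_comp_fermiThetaLin]

/-- **The conjugate character**: `conj (∏_f (((s̄)⁻¹)_f)^{q_f}) = ∏_f s_f^{(−q)_f}` (also at `s_f = 0`,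
where both sides use `0⁻¹ = 0`). -/
theorem conj_prod_star_inv_zpow (s : Fin Nf → ℂ) (q : Fin Nf → ℤ) :
    conj (∏ f, (star s)⁻¹ f ^ (q f)) = ∏ f, s f ^ ((-q) f) := by
  rw [map_prod]
  refine Finset.prod_congr rfl fun f _ => ?_
  rw [map_zpow₀, Pi.inv_apply, Pi.star_apply, map_inv₀, starRingEnd_apply, star_star, inv_zpow',
    Pi.neg_apply]

/-! ### The registered stub -/

/-- **Stub `stub_osAdjoint_charge` of the birth skeleton of `TorusHalfSpectrum` (= `OsAdjointChargeStmt`)**: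
the Osterwalder–Seiler adjoint of a flavour-homogeneous observable of charge `q` is flavour-homogeneous of
charge `−q`: `flavourScale s ((ΘA)(U)) = Θ (flavourScale (s̄)⁻¹ (A(θU))) = Θ ((∏ ((s̄)⁻¹_f)^{q_f}) • A(θU))
= conj (∏ ((s̄)⁻¹_f)^{q_f}) • (ΘA)(U) = (∏ s_f^{−q_f}) • (ΘA)(U)` (`flavourScale_fermiTheta`, the hypothesis at
`(s̄)⁻¹ ∈ (ℂˣ)^{N_f}`, antilinearity `LinearMap.map_smulₛₗ`, `conj_prod_star_inv_zpow`). -/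
theorem stub_osAdjoint_charge :
    ∀ (Nf R : ℕ) (A : QCDLatticeObservable Nf R) (q : Fin Nf → ℤ),
      (∀ t : Fin Nf → ℂ, (∀ f, t f ≠ 0) → ∀ U,
          QCDLatticeObservable.flavourScale t (A.F U) = (∏ f, t f ^ (q f)) • A.F U) →
      ∀ t : Fin Nf → ℂ, (∀ f, t f ≠ 0) → ∀ U,
          QCDLatticeObservable.flavourScale t (A.osAdjoint.F U) = (∏ f, t f ^ ((-q) f)) • A.osAdjoint.F U := by
  intro Nf R A q hA s hs U
  have hs' : ∀ f, (star s)⁻¹ f ≠ 0 := fun f => by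
    rw [Pi.inv_apply, Pi.star_apply]
    exact inv_ne_zero (star_ne_zero.2 (hs f))
  rw [QCDLatticeObservable.osAdjoint_F, flavourScale_fermiTheta, hA _ hs' _, LinearMap.map_smulₛₗ,
    conj_prod_star_inv_zpow]

end Summit.QuantumFields.QCD.Cruxes.TorusHalfSpectrum.Birth.OsAdjointCharge

end
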